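import Summits.MatrixMultiplication.MatrixMultiplication.Theorems.SoloInformedCwTwoOrientHall

/-!
# Reindexing the pairs of a mixed system (solo-informed, gen 13; CLAIMS c161)

HALL-6 and its oriented form are invariant under permuting the pairs: if `o` works for `(s, d ; t)` then
`o ∘ σ` works for `(s ∘ σ, d ∘ σ ; t)` for every permutation `σ` of the pair indices.  Together with the demotion
lemma for the LAST pair (`SoloInformedCwTwoDemotion`), this lets any pair be demoted to two singletons.

Standard axioms only.
-/

namespace Summit.MatrixMultiplication.MatrixMultiplication.Theorems

open Finset

/-- The word of the original system corresponding to a word of the reindexed system. -/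
def reindexWord {p q : ℕ} (σ : Equiv.Perm (Fin p)) (m : HWord p q) : HWord p q :=
  (fun j => m.1 (σ.symm j), m.2)

/-- `reindexWord σ` is injective. -/
lemma reindexWord_injective {p q : ℕ} (σ : Equiv.Perm (Fin p)) :
    Function.Injective (reindexWord (q := q) σ) := by
  intro m₁ m₂ h
  simp only [reindexWord, Prod.mk.injEq] at h
  obtain ⟨h1, h2⟩ := h
  refine Prod.ext (funext fun k => ?_) h2
  have := congrFun h1 (σ k)
  simpa using this

/-- The cost is invariant under reindexing the pairs. -/
lemma mixedSigma_reindex {p q : ℕ} (s d : Fin p → ℕ) (t : Fin q → ℕ) (σ : Equiv.Perm (Fin p)) :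
    mixedSigma (fun k => s (σ k)) (fun k => d (σ k)) t = mixedSigma s d t := by
  unfold mixedSigma
  rw [Equiv.sum_comp σ (fun j => s j + d j)]

/-- Representative values are invariant under reindexing (choices transported along `σ`). -/
lemma candVal_reindex {p q : ℕ} (s d : Fin p → ℕ) (t : Fin q → ℕ) (σ : Equiv.Perm (Fin p)) (m : HWord p q)
    (e : Fin p → Fin 3) :
    candVal (fun k => s (σ k)) (fun k => d (σ k)) t m (fun k => e (σ k)) =
      candVal s d t (reindexWord σ m) e := by
  unfold candVal reindexWord
  congr 1
  rw [← Equiv.sum_comp σ (fun j => if m.1 (σ.symm j) = 3 then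
      (![2 * s j, s j + d j, 2 * d j] : Fin 3 → ℕ) (e j) else (![0, s j, d j, s j + d j] : Fin 4 → ℕ) (m.1 (σ.symm j)))]
  simp only [Equiv.symm_apply_apply]

/-- **HALL-6 is invariant under reindexing the pairs.** -/
theorem hallSix_reindex {p q : ℕ} (s d : Fin p → ℕ) (t : Fin q → ℕ) (σ : Equiv.Perm (Fin p))
    (h : HallSix s d t) : HallSix (fun k => s (σ k)) (fun k => d (σ k)) t := by
  obtain ⟨ε, hle, hinj⟩ := h
  refine ⟨fun m k => ε (reindexWord σ m) (σ k), fun m => ?_, fun m₁ m₂ hm => ?_⟩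
  · rw [candVal_reindex, mixedSigma_reindex]; exact hle _
  · have h' := hm
    simp only [candVal_reindex] at h'
    exact reindexWord_injective σ (hinj h')

/-- **Working orientations transport under reindexing the pairs**: if `o` works for `(s, d ; t)` then `o ∘ σ`
works for `(s ∘ σ, d ∘ σ ; t)`. -/
theorem orientedHallSix_reindex {p q : ℕ} (s d : Fin p → ℕ) (t : Fin q → ℕ) (o : Fin p → Bool)
    (σ : Equiv.Perm (Fin p)) (h : OrientedHallSix s d t o) :
    OrientedHallSix (fun k => s (σ k)) (fun k => d (σ k)) t (fun k => o (σ k)) := by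
  obtain ⟨ε, hor, hle, hinj⟩ := h
  refine ⟨fun m k => ε (reindexWord σ m) (σ k), fun m k => hor (reindexWord σ m) (σ k), fun m => ?_,
    fun m₁ m₂ hm => ?_⟩
  · rw [candVal_reindex, mixedSigma_reindex]; exact hle _
  · have h' := hm
    simp only [candVal_reindex] at h'
    exact reindexWord_injective σ (hinj h')

end Summit.MatrixMultiplication.MatrixMultiplication.Theorems
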